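import Literature.Barriers.CriticalPhenomena.LaceExpansionXSpaceWeightedNLoop
import Literature.Barriers.CriticalPhenomena.LaceExpansionXSpaceHPiece
import Literature.Barriers.CriticalPhenomena.LaceExpansionDiagramBound7410
import HarnessLib

/-!
# Hara's Lemma 1.6 (percolation) with the printed hypotheses: the `H̄^{(β)}`-route at `γ = 0`, and the
# statement the printed case analysis proves — `W̄^{(β,γ)}, T̄^{(0,γ)}, H̄^{(β)} < ∞` plus `0 < γ → T̄^{(0,β)} < ∞`

Barrier catalogue `Literature/Barriers/CriticalPhenomena/` (D-0021), last layer of the decomposition of the named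
fact `Hara2008_lemma16Pc` (`LaceExpansionXSpaceNorms.lean`; Hara 2008, Lemma 1.6: "For percolation with `λ`
sufficiently small, suppose `W̄^{(β,γ)}`, `T̄^{(0,γ)}` and `H̄^{(β)}` are finite for some `β, γ ≥ 0`. Then
`Σ_x |x|^{β+γ}|Π(x)| < ∞`"), companion of `LaceExpansionXSpaceWeightedNLoop.lean` (the `T̄^{(0,β)}`-variant) and
`LaceExpansionXSpaceHPiece.lean` (the `H`-piece `‖B₁ B̃₂⁽²⁾^{(β,c)} B₁‖_mix ≤ |0|^c p_c²(2d)² H̄^{(β)}`, case (b-7)).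

WHAT IS PROVED HERE. (i) At `γ = 0` (no `γ`-mark) Hara's printed route goes through on the diagrams (7.4.10): the
`β`-mark on the path line of a `B₂` kernel is bounded by `W̄^{(β,0)}` between two pivotal triangles (`B₂⁽¹⁾`, case
(b-2) with one weight) plus the `H`-piece (`B₂⁽²⁾`, case (b-7)), all other positions as in
`LaceExpansionXSpaceChainSplits.lean`; whence `chain_exv_zero_right_le` (every singly marked chain
`≤ C_H(β) K^{N-5}`), `CbigH_lt_top` (finite under EXACTLY the printed hypotheses at `γ = 0`:
`W̄^{(β,0)}, T̄^{(0,0)}, H̄^{(β)} < ∞`), `weightedNLoopBoundH_of_small` and `Hara2008_lemma16H_of_diagramBounds`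
(Lemma 1.6 at `γ = 0` as printed, from `HvdH2017_piNDiagramBoundPc` and `2Δ̃_{p_c}Δ_{p_c} < 1`). (ii) Combined with
the `T̄^{(0,β)}`-variant for `γ > 0`: `Hara2008_lemma16_of_diagramBounds` / `Hara2008_lemma16_of_triangleBounds` —
Lemma 1.6 with the printed hypotheses `W̄^{(β,γ)}, T̄^{(0,γ)}, H̄^{(β)} < ∞` and the single conditional addition
`0 < γ → T̄^{(0,β)} < ∞`, from the catalogue's two named inputs `HvdH2017_piNDiagramBoundPc` and
`FitznerVanDerHofstad2017_triangleBoundsPc`; and `Hara2008_lemma16Pc_of_triangleBounds` — the named fact itself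
from those two inputs and the one estimate the printed proof does not supply (`T̄^{(0,β)} < ∞` for `γ > 0`). (iii) Since the first
input is PROVED in the catalogue (`HvdH2017_piNDiagramBoundPc_holds`, `LaceExpansionDiagramBound7410.lean`), the same
three statements from the numerical triangle bounds ALONE: `Hara2008_lemma16T_of_numerics`, `Hara2008_lemma16_of_numerics`,
`Hara2008_lemma16Pc_of_numerics (hnum) (hgap) : Hara2008_lemma16Pc`. (The re-run of the bootstrap of §1.2.4 on the
`T̄^{(0,β)}`-variant is `LaceExpansionEtaZeroXSpaceNumerics.lean`.)

WHY THE ADDITION (scope of the printed proof; see also the module docstring of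
`LaceExpansionXSpaceWeightedNLoop.lean`). Step 1 of §3.4 places `|x|^β` on a line of the upper and `|x|^γ` on a
line of the lower of the two disjoint paths `0 → x`; through a unit whose `B₂` is the second term `B₂⁽²⁾` of
(7.4.4) the two line-disjoint paths are forced (the unit is entered and left through two-line cuts): one path
consists of the pivotal line into the vertex `v` of Hara's `H` alone, the other runs along the chord
`G^{(β)}(x)` of the triangle `0, u, x`. With `β` on the chord and `γ` on a line at `v` (the pivotal line
`G(z+a-v)` or the line `G(y+b-v)`), the middle factor is `H^{(β)}(a,b)` with one `v`-leg `γ`-weighted: the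
`γ`-weight cannot be moved off the eight lines of `H` (every walk between the endpoints of that line passes
through `v`), the `β`-weight cannot leave the triangle without doubling a weight on one line, and once `v` is
decoupled from the left the `β`-triangle closes to `T^{(β,0)}(0) ≤ T̄^{(0,β)}`. None of the three printed
alternatives `W̄^{(β,γ)}`, `W̄^{(β,0)}T̄^{(0,γ)}`, `H̄^{(β)}T̄^{(0,γ)}` of (3.30) bounds this configuration; it does not
occur when `γ = 0`. In the application (§1.2.4, `β = 2`; `LaceExpansionXSpaceBootstrapT.lean`) the addition
`T̄^{(0,2)} < ∞` is supplied by Lemma 1.7.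

## References

* T. Hara, Ann. Probab. 36 (2008) 530–593 (arXiv:math-ph/0504021): Lemma 1.6; §1.1 (definition of `H^{(β)}(a,b)`);
  §3.4 (Steps 1–3 and Summary, cases (b-2), (b-3), (b-7): "This is nothing but `H^{(β)}(a,b)` … [Other parts can be
  decomposed into triangles and `T^{(0,γ)}`]", (3.30)); §1.2.4.
* M. Heydenreich, R. van der Hofstad, *Progress in High-Dimensional Percolation and Random Graphs*, Springer 2017:
  (7.4.4), (7.4.10), (7.5.1)–(7.5.2), §7.5.2, Prop. 7.4, Cor. 8.13.
* R. Fitzner, R. van der Hofstad, Electron. J. Probab. 22 (2017) no. 43: §7 ((7.1), proofs of Thms. 1.4–1.5).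
-/

noncomputable section

namespace Literature.Barriers.CriticalPhenomena

open _root_.MeasureTheory _root_.Filter Literature.Probability.LatticeModels
  Literature.Probability.Percolation

open scoped ENNReal

/-! ### `γ = 0`: the printed route through `H̄^{(β)}` (case (b-7))

With no `γ`-mark (`c = 0`) the `β`-mark on the path line of a `B₂` kernel whose neighbours are unmarked is bounded
as printed: the `B₂⁽¹⁾` part by `W̄^{(β,0)}` between two pivotal triangles (case (b-2) with one weight), the `B₂⁽²⁾`
part by the `H`-piece `‖B₁ B̃₂⁽²⁾^{(β,0)} B₁‖_mix ≤ p_c²(2d)² H̄^{(β)}` (case (b-7), `LaceExpansionXSpaceHPiece.lean`).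
This gives Lemma 1.6 at `γ = 0` under exactly the printed hypotheses `W̄^{(β,0)}, T̄^{(0,0)}, H̄^{(β)} < ∞`. -/

section HRoute

variable {d : ℕ}

/-- Hara's constant of the `H`-piece: `p_c² (2d)² H̄^{(b)}` (the two pivotal lines of (7.4.10) averaged over the
`2d` unit vectors). [cite: Hara2008, §3.4 (Step 2, case (b-7))] -/
def hB (d : ℕ) (b : ℝ) : ℝ≥0∞ := ENNReal.ofReal (criticalProbI d) ^ 2 * ((2 * d) ^ 2 * haraHBar d b)

/-- **The middle factor with `b` on the path line of `B₂` and unmarked neighbours**: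
`‖B₁ B̃₂^{(b,0)} B₁‖_mix ≤ ‖B₁ρ‖_{∞→∞} W̄^{(b,0)} ‖ρB₁‖_{1→1} + p_c²(2d)² H̄^{(b)}` (first term: `B₂⁽¹⁾`, case (b-2) with one
weight; second term: `B₂⁽²⁾`, case (b-7)). [cite: Hara2008, §3.4 (Step 2, cases (b-2) and (b-7))] -/
theorem pkNormMix_kB1_kB2W_kB1_le_hB (b : ℝ) :
    pkNormMix (pkMul (kB1w d 0 0) (pkMul (kB2W d b 0) (kB1w d 0 0))) ≤
      pkNormInf (kRungR (kB1w d 0 0)) * haraWBar d b 0 * pkNormOne (kRungL (kB1w d 0 0)) + hB d b := by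
  rw [show kB2W d b 0 = fun p q => kB2oneW d b 0 p q + kB2twoW d b 0 p q from rfl,
    pkMul_add_left, pkMul_add_right]
  refine (pkNormMix_add_le _ _).trans (add_le_add ?_ ?_)
  · exact pkNormMix_mid_kB2oneW_le _ _ (pkTI_kB1w _ _) b 0
  · rw [kB1w_zero_zero]
    refine (pkNormMix_kB1_kB2twoW_kB1_le b 0).trans (le_of_eq ?_)
    rw [wE_zero_exp, one_mul, hB]

/-- **Split at the `B₂` of unit `u` with any bound on the middle factor** `‖B̃₁^{(u)} B̃₂^{(u)} B̃₁^{(u+1)}‖_mix ≤ B`.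
[cite: Hara2008, §3.4 (Step 2)] [cite: HeydenreichVanDerHofstad2017, (7.5.26)–(7.5.27)] -/
theorem chain_le_split_B2_of_mid (n : ℕ) (ex : ℕ → ℝ × ℝ) {u : ℕ} (hu1 : 1 ≤ u) (hun : u ≤ n) {B : ℝ≥0∞}
    (hmid : pkNormMix (pkMul (kB1w d (ex (2 * u - 1)).1 (ex (2 * u - 1)).2)
      (pkMul (kB2W d (ex (2 * u)).1 (ex (2 * u)).2) (kB1w d (ex (2 * u + 1)).1 (ex (2 * u + 1)).2))) ≤ B) :
    ∑' p, pkChainL (vDelta d) (mKsE d n ex) p * eDiag d p ≤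
      pkNormInf (kStartW d (ex 0).1 (ex 0).2) * lnorm d ex 0 (u - 1) * B * rnormK d ex (u + 1) (n - u) := by
  rw [mKsE_split_B1 n ex hu1 (by omega), pkChainL_cons, show n + 1 - u = (n - u) + 1 by omega, RListK,
    show kB1w d (ex (2 * u - 1)).1 (ex (2 * u - 1)).2 :: kB2W d (ex (2 * u)).1 (ex (2 * u)).2 ::
        kB1w d (ex (2 * u + 1)).1 (ex (2 * u + 1)).2 :: RListK d ex (u + 1) (n - u) =
      kB1w d (ex (2 * u - 1)).1 (ex (2 * u - 1)).2 :: ([kB2W d (ex (2 * u)).1 (ex (2 * u)).2,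
        kB1w d (ex (2 * u + 1)).1 (ex (2 * u + 1)).2] ++ RListK d ex (u + 1) (n - u)) from rfl]
  refine (tsum_pkChainL_three_factor _ _ _ _ _ _ (pkTI_of_mem_RListK ex _ (u + 1)) pvTI_eDiag).trans ?_
  refine mul_le_mul' (mul_le_mul' ?_ ?_) (tsum_pkChainR_RListK_le ex _ (u + 1))
  · exact (tsum_pkChainL_blocksKs_le ex _ 0 _).trans (mul_le_mul' (tsum_pkVmul_vDelta_le _) le_rfl)
  · rw [pkProd_cons, pkProd_cons, pkProd_nil]
    exact hmid

/-- Without a `c`-mark the exponents away from the `b`-mark vanish. [folklore] -/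
theorem exv_zero_right_of_ne {j : ℕ} (l : ℕ) (b : ℝ) {k : ℕ} (hk : k ≠ j) : exv j l b 0 k = (0, 0) := by
  unfold exv; rw [if_neg hk]; split_ifs <;> rfl

/-- Without a `c`-mark the exponent at the `b`-mark is `(b,0)` or `(0,b)` according to the path. [folklore] -/
theorem exv_zero_right_self (j l : ℕ) (b : ℝ) : exv j l b 0 j = if pol j then (b, 0) else (0, b) := by
  unfold exv; rw [if_pos rfl]; split_ifs <;> rfl

/-- `(0,0)` is a pattern without `c`-mark. [folklore] -/
theorem zero_mem_patsC_zero : ((0 : ℝ), (0 : ℝ)) ∈ patsC 0 := by simp [patsC]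

/-- **The constant of the singly marked chains through `H̄^{(b)}`** (uniform in `N` and in the position of the
mark): Hara's (3.30) at `γ = 0`, `(2N+1)^β [W̄^{(β,0)} or H̄^{(β)}] × (triangles)`.
[cite: Hara2008, §3.4 (Step 3, (3.30) with γ = 0)] -/
def CbigH (d : ℕ) (b : ℝ) : ℝ≥0∞ :=
  (1 + Ssum d 0) ^ 2 * (1 + Usum d 0) ^ 2 * ((1 + Msum d b 0) * (1 + Rsum d 0) +
    (1 + Wsum d b 0) * (1 + Rsum d 0) ^ 2 + (1 + Msum d b 0) * (1 + haraTBar d 0 0) * (1 + Rsum d 0) + hB d b)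

/-- The `B₂`-case of `chain_exv_zero_right_le` with the mark on the chord (`P₁` through the `B₂` path line):
`W̄^{(b,0)}` between pivotal triangles and the `H`-piece. [cite: Hara2008, §3.4 (Step 2, cases (b-2), (b-7))] -/
theorem chain_exv_zero_right_le_chord {b : ℝ} (hb : 0 ≤ b) (hKB : KB d ≤ 1) (n : ℕ) {j : ℕ} (l : ℕ) {u : ℕ}
    (hj2 : j = 2 * u) (hu1 : 1 ≤ u) (hun : u ≤ n) (hp : pol j) :
    ∑' p, pkChainL (vDelta d) (mKsE d n (exv j l b 0)) p * eDiag d p ≤ CbigH d b * KB d ^ (n - 4) := by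
  set ex := exv j l b 0 with hex
  have hpat : ∀ k, ex k ∈ pats b 0 := fun k => exv_mem_pats j l b 0 k
  have hpatC : ∀ k, k ≠ j → ex k ∈ patsC 0 := fun k hk => exv_mem_patsC b 0 hk
  set S := 1 + Ssum d 0 with hS
  set U := 1 + Usum d 0 with hU
  set M := 1 + Msum d b 0 with hM
  set R := 1 + Rsum d 0 with hR
  set W := 1 + Wsum d b 0 with hW
  set T := 1 + haraTBar d 0 0 with hT
  have e0 : pkNormInf (kStartW d (ex 0).1 (ex 0).2) ≤ S := pkNormInf_kStartW_le_Ssum (hpatC 0 (by omega))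
  have e1 : lnorm d ex 0 (u - 1) ≤ U * KB d ^ (u - 1 - 1) := lnorm_exv_le hb le_rfl hKB (u - 1) 0 (by omega)
  have e7 : rnormK d ex (u + 1) (n - u) ≤ U * KB d ^ (n - u - 1) * S :=
    rnormK_exv_le hb le_rfl hKB (n - u) (u + 1) (by omega)
  have hx1 : ex (2 * u - 1) = (0, 0) := exv_zero_right_of_ne l b (by omega)
  have hx3 : ex (2 * u + 1) = (0, 0) := exv_zero_right_of_ne l b (by omega)
  have hx2 : ex (2 * u) = (b, 0) := by rw [hex, ← hj2, exv_zero_right_self, if_pos hp]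
  have eR0 : pkNormInf (kRungR (kB1w d 0 0)) ≤ R :=
    (pkNormInf_kRungR_kB1w_le_rungB (e := ((0 : ℝ), (0 : ℝ))) le_rfl).trans (rungB_le_Rsum zero_mem_patsC_zero)
  have eR0' : pkNormOne (kRungL (kB1w d 0 0)) ≤ R :=
    (pkNormOne_kRungL_kB1w_le_rungB (e := ((0 : ℝ), (0 : ℝ))) le_rfl).trans (rungB_le_Rsum zero_mem_patsC_zero)
  have eW : haraWBar d b 0 ≤ W := by
    have h := haraWBar_le_Wsum (d := d) (hpat (2 * u))
    rwa [hx2] at h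
  have hmid0 : pkNormMix (pkMul (kB1w d 0 0) (pkMul (kB2W d b 0) (kB1w d 0 0))) ≤ R * W * R + hB d b :=
    (pkNormMix_kB1_kB2W_kB1_le_hB b).trans (add_le_add (mul_le_mul' (mul_le_mul' eR0 eW) eR0') le_rfl)
  have hmid : pkNormMix (pkMul (kB1w d (ex (2 * u - 1)).1 (ex (2 * u - 1)).2)
      (pkMul (kB2W d (ex (2 * u)).1 (ex (2 * u)).2) (kB1w d (ex (2 * u + 1)).1 (ex (2 * u + 1)).2))) ≤
      R * W * R + hB d b := by
    rw [hx1, hx2, hx3]; exact hmid0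
  refine (chain_le_split_B2_of_mid n ex hu1 hun hmid).trans ?_
  calc _ ≤ S * (U * KB d ^ (u - 1 - 1)) * (R * W * R + hB d b) * (U * KB d ^ (n - u - 1) * S) :=
        mul_le_mul' (mul_le_mul' (mul_le_mul' e0 e1) le_rfl) e7
    _ = S ^ 2 * U ^ 2 * (W * R ^ 2 + hB d b) * (KB d ^ (u - 1 - 1) * KB d ^ (n - u - 1)) := by ring
    _ ≤ S ^ 2 * U ^ 2 * (M * R + W * R ^ 2 + M * T * R + hB d b) * KB d ^ (n - 4) := by
        refine mul_le_mul' (mul_le_mul' le_rfl (add_le_add ?_ le_rfl)) (KB_pow_mul_pow_le hKB (by omega))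
        exact le_add_self.trans le_self_add

/-- The `B₂`-case of `chain_exv_zero_right_le` with the mark on the `t → w'` line of `B₂` (the other path):
`W̄^{(0,b)}` between pivotal triangles and `|0|^b T̄^{(0,0)}`. [cite: Hara2008, §3.4 (Step 2, cases (b-2), (b-3))] -/
theorem chain_exv_zero_right_le_cross {b : ℝ} (hb : 0 ≤ b) (hKB : KB d ≤ 1) (n : ℕ) {j : ℕ} (l : ℕ) {u : ℕ}
    (hj2 : j = 2 * u) (hu1 : 1 ≤ u) (hun : u ≤ n) (hp : ¬ pol j) :
    ∑' p, pkChainL (vDelta d) (mKsE d n (exv j l b 0)) p * eDiag d p ≤ CbigH d b * KB d ^ (n - 4) := by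
  set ex := exv j l b 0 with hex
  have hpat : ∀ k, ex k ∈ pats b 0 := fun k => exv_mem_pats j l b 0 k
  have hpatC : ∀ k, k ≠ j → ex k ∈ patsC 0 := fun k hk => exv_mem_patsC b 0 hk
  have hnn : ∀ k, 0 ≤ (ex k).1 ∧ 0 ≤ (ex k).2 := fun k => nonneg_of_mem_pats hb le_rfl (hpat k)
  set S := 1 + Ssum d 0 with hS
  set U := 1 + Usum d 0 with hU
  set M := 1 + Msum d b 0 with hM
  set R := 1 + Rsum d 0 with hR
  set W := 1 + Wsum d b 0 with hW
  set T := 1 + haraTBar d 0 0 with hT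
  have e0 : pkNormInf (kStartW d (ex 0).1 (ex 0).2) ≤ S := pkNormInf_kStartW_le_Ssum (hpatC 0 (by omega))
  have e1 : lnorm d ex 0 (u - 1) ≤ U * KB d ^ (u - 1 - 1) := lnorm_exv_le hb le_rfl hKB (u - 1) 0 (by omega)
  have e7 : rnormK d ex (u + 1) (n - u) ≤ U * KB d ^ (n - u - 1) * S :=
    rnormK_exv_le hb le_rfl hKB (n - u) (u + 1) (by omega)
  have hx2 : ex (2 * u) = (0, b) := by rw [hex, ← hj2, exv_zero_right_self, if_neg hp]
  have e2 : pkNormInf (kRungR (kB1w d (ex (2 * u - 1)).1 (ex (2 * u - 1)).2)) ≤ R :=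
    (pkNormInf_kRungR_kB1w_le_rungB (hnn _).2).trans (rungB_le_Rsum (hpatC _ (by omega)))
  have e3 : haraWBar d (ex (2 * u)).1 (ex (2 * u)).2 ≤ W := haraWBar_le_Wsum (hpat _)
  have e4 : pkNormOne (kRungL (kB1w d (ex (2 * u + 1)).1 (ex (2 * u + 1)).2)) ≤ R :=
    (pkNormOne_kRungL_kB1w_le_rungB (hnn _).2).trans (rungB_le_Rsum (hpatC _ (by omega)))
  have e5 : pkNormMix (kB1w d (ex (2 * u - 1)).1 (ex (2 * u - 1)).2) ≤ M :=
    (pkNormMix_kB1w_le_mixB (hnn _).2).trans (mixB_le_Msum (hpat _))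
  have e6 : wE (ex (2 * u)).2 (0 : Site d) * haraTBar d 0 (ex (2 * u)).1 ≤ T := by
    have h6 : wE b (0 : Site d) * haraTBar d 0 0 ≤ T := (mul_le_of_le_one_left' (wE_zero_le_one b)).trans le_add_self
    rwa [hx2]
  refine (chain_le_split_B2 n ex hu1 hun).trans ?_
  calc _ ≤ S * (U * KB d ^ (u - 1 - 1)) * (R * W * R + M * (T * R)) * (U * KB d ^ (n - u - 1) * S) :=
        mul_le_mul' (mul_le_mul' (mul_le_mul' e0 e1) (add_le_add (mul_le_mul' (mul_le_mul' e2 e3) e4)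
          (mul_le_mul' e5 (mul_le_mul' e6 e4)))) e7
    _ = S ^ 2 * U ^ 2 * (W * R ^ 2 + M * T * R) * (KB d ^ (u - 1 - 1) * KB d ^ (n - u - 1)) := by ring
    _ ≤ S ^ 2 * U ^ 2 * (M * R + W * R ^ 2 + M * T * R + hB d b) * KB d ^ (n - 4) := by
        refine mul_le_mul' (mul_le_mul' le_rfl ?_) (KB_pow_mul_pow_le hKB (by omega))
        have h1 : W * R ^ 2 + M * T * R ≤ M * R + W * R ^ 2 + M * T * R :=
          add_le_add (le_add_self : W * R ^ 2 ≤ M * R + W * R ^ 2) le_rfl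
        exact h1.trans le_self_add

/-- **Every singly marked chain of the diagram of `Π^{(N)}` is at most `C_H(b) K^{N-5}`** (`N = n+1`; mark at
`j < 2N+1`, any `l`; `K = 2Δ̃_{p_c}Δ_{p_c} ≤ 1`): Hara's Step 2 with the `H`-piece for the mark on the path line of a
`B₂⁽²⁾`. [cite: Hara2008, §3.4 (Steps 2–3, cases (b-2), (b-3), (b-7))] [cite: HeydenreichVanDerHofstad2017, §7.5.2] -/
theorem chain_exv_zero_right_le {b : ℝ} (hb : 0 ≤ b) (hKB : KB d ≤ 1) (n : ℕ) {j : ℕ} (l : ℕ)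
    (hj : j < 2 * n + 3) :
    ∑' p, pkChainL (vDelta d) (mKsE d n (exv j l b 0)) p * eDiag d p ≤ CbigH d b * KB d ^ (n - 4) := by
  set ex := exv j l b 0 with hex
  have hpat : ∀ k, ex k ∈ pats b 0 := fun k => exv_mem_pats j l b 0 k
  have hpatC : ∀ k, k ≠ j → ex k ∈ patsC 0 := fun k hk => exv_mem_patsC b 0 hk
  have hnn : ∀ k, 0 ≤ (ex k).1 ∧ 0 ≤ (ex k).2 := fun k => nonneg_of_mem_pats hb le_rfl (hpat k)
  -- abbreviations of the sums
  set S := 1 + Ssum d 0 with hS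
  set U := 1 + Usum d 0 with hU
  set M := 1 + Msum d b 0 with hM
  set R := 1 + Rsum d 0 with hR
  set W := 1 + Wsum d b 0 with hW
  set T := 1 + haraTBar d 0 0 with hT
  have h1S : 1 ≤ S := le_self_add
  have h1U : 1 ≤ U := le_self_add
  have h1M : 1 ≤ M := le_self_add
  have h1R : 1 ≤ R := le_self_add
  have h1W : 1 ≤ W := le_self_add
  have h1T : 1 ≤ T := le_self_add
  have hCbig : CbigH d b = S ^ 2 * U ^ 2 * (M * R + W * R ^ 2 + M * T * R + hB d b) := rfl
  -- the positions of the `b`-mark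
  rcases Nat.eq_zero_or_pos j with hj0 | hjpos
  · -- `j = 0`: split at the start
    subst hj0
    refine (chain_le_split_start n ex).trans ?_
    have e1 : pkNormMix (kProp (gE d (ex 0).1) (gE d (ex 0).2)) ≤ W :=
      (pkNormMix_kProp_gE_le _ _).trans (haraWBar_le_Wsum (hpat 0))
    have e2 : pkNormOne (kRungL (kB1w d (ex 1).1 (ex 1).2)) ≤ R :=
      (pkNormOne_kRungL_kB1w_le_rungB (hnn 1).2).trans (rungB_le_Rsum (hpatC 1 (by omega)))
    have e3 : rnormK d ex 1 n ≤ U * KB d ^ (n - 1) * S := rnormK_exv_le hb le_rfl hKB n 1 (by omega)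
    calc _ ≤ W * (R * (U * KB d ^ (n - 1) * S)) := mul_le_mul' e1 (mul_le_mul' e2 e3)
      _ = S * U * (W * R) * KB d ^ (n - 1) := by ring
      _ ≤ S ^ 2 * U ^ 2 * (M * R + W * R ^ 2 + M * T * R + hB d b) * KB d ^ (n - 4) := by
          refine mul_le_mul' ?_ (pow_le_pow_right_of_le_one' hKB (by omega))
          refine mul_le_mul' (mul_le_mul' ?_ ?_) ?_
          · rw [pow_two]; exact le_mul_of_one_le_right' h1S
          · rw [pow_two]; exact le_mul_of_one_le_right' h1U
          · calc W * R ≤ W * R ^ 2 := mul_le_mul' le_rfl (by rw [pow_two]; exact le_mul_of_one_le_right' h1R)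
              _ ≤ M * R + W * R ^ 2 := le_add_self
              _ ≤ _ := le_self_add.trans le_self_add
  by_cases hjend : j = 2 * n + 2
  · -- `j = 2n+2`: split at the end
    subst hjend
    refine (chain_le_split_end n ex).trans ?_
    have e0 : pkNormInf (kStartW d (ex 0).1 (ex 0).2) ≤ S := pkNormInf_kStartW_le_Ssum (hpatC 0 (by omega))
    have e1 : lnorm d ex 0 n ≤ U * KB d ^ (n - 1) := lnorm_exv_le hb le_rfl hKB n 0 (by omega)
    have e2 : pkNormInf (kRungR (kB1w d (ex (2 * n + 1)).1 (ex (2 * n + 1)).2)) ≤ R :=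
      (pkNormInf_kRungR_kB1w_le_rungB (hnn _).2).trans (rungB_le_Rsum (hpatC _ (by omega)))
    have e3 : pkNormMix (kProp (gE d (ex (2 * n + 2)).1) (gE d (ex (2 * n + 2)).2)) ≤ W :=
      (pkNormMix_kProp_gE_le _ _).trans (haraWBar_le_Wsum (hpat _))
    calc _ ≤ S * (U * KB d ^ (n - 1)) * (R * W) := mul_le_mul' (mul_le_mul' e0 e1) (mul_le_mul' e2 e3)
      _ = S * U * (W * R) * KB d ^ (n - 1) := by ring
      _ ≤ S ^ 2 * U ^ 2 * (M * R + W * R ^ 2 + M * T * R + hB d b) * KB d ^ (n - 4) := by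
          refine mul_le_mul' ?_ (pow_le_pow_right_of_le_one' hKB (by omega))
          refine mul_le_mul' (mul_le_mul' ?_ ?_) ?_
          · rw [pow_two]; exact le_mul_of_one_le_right' h1S
          · rw [pow_two]; exact le_mul_of_one_le_right' h1U
          · calc W * R ≤ W * R ^ 2 := mul_le_mul' le_rfl (by rw [pow_two]; exact le_mul_of_one_le_right' h1R)
              _ ≤ M * R + W * R ^ 2 := le_add_self
              _ ≤ _ := le_self_add.trans le_self_add
  rcases Nat.even_or_odd j with ⟨u, hu⟩ | ⟨u', hu'⟩
  · -- `j = 2u`, `1 ≤ u ≤ n`: split at the `B₂` of unit `u`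
    by_cases hp : pol j
    · exact chain_exv_zero_right_le_chord hb hKB n l (u := u) (by omega) (by omega) (by omega) hp
    · exact chain_exv_zero_right_le_cross hb hKB n l (u := u) (by omega) (by omega) (by omega) hp
  · -- `j = 2u'+1 = 2u-1`, `1 ≤ u ≤ n+1`: split at the `B₁` of unit `u`
    set u := u' + 1 with hu
    have hj2 : j = 2 * u - 1 := by omega
    have hu1 : 1 ≤ u := by omega
    have hun : u ≤ n + 1 := by omega
    refine (chain_le_split_B1 n ex hu1 hun).trans ?_
    have e0 : pkNormInf (kStartW d (ex 0).1 (ex 0).2) ≤ S := pkNormInf_kStartW_le_Ssum (hpatC 0 (by omega))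
    have e1 : lnorm d ex 0 (u - 1) ≤ U * KB d ^ (u - 1 - 1) := lnorm_exv_le hb le_rfl hKB (u - 1) 0 (by omega)
    have e2 : pkNormMix (kB1w d (ex (2 * u - 1)).1 (ex (2 * u - 1)).2) ≤ M :=
      (pkNormMix_kB1w_le_mixB (hnn _).2).trans (mixB_le_Msum (hpat _))
    have e3 : rnormK d ex u (n + 1 - u) ≤ U * KB d ^ (n + 1 - u - 1) * S :=
      rnormK_exv_le hb le_rfl hKB (n + 1 - u) u (by omega)
    calc _ ≤ S * (U * KB d ^ (u - 1 - 1)) * M * (U * KB d ^ (n + 1 - u - 1) * S) :=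
          mul_le_mul' (mul_le_mul' (mul_le_mul' e0 e1) e2) e3
      _ = S ^ 2 * U ^ 2 * M * (KB d ^ (u - 1 - 1) * KB d ^ (n + 1 - u - 1)) := by ring
      _ ≤ S ^ 2 * U ^ 2 * (M * R + W * R ^ 2 + M * T * R + hB d b) * KB d ^ (n - 4) := by
          refine mul_le_mul' (mul_le_mul' le_rfl ?_) (KB_pow_mul_pow_le hKB (by omega))
          exact (le_mul_of_one_le_right' h1R).trans (le_self_add.trans (le_self_add.trans le_self_add))

/-- **The constant is finite** under the printed hypotheses at `γ = 0`: `W̄^{(β,0)}, T̄^{(0,0)}, H̄^{(β)} < ∞`.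
[cite: Hara2008, §3.4 (Step 3: "with a finite constant c") and Lemma 1.6 (γ = 0)] -/
theorem CbigH_lt_top {β : ℝ} (hβ : 0 ≤ β) (hW : haraWBar d β 0 < ⊤) (hT : haraTBar d 0 0 < ⊤)
    (hH : haraHBar d β < ⊤) : CbigH d β < ⊤ := by
  have hone : (1 : ℝ≥0∞) < ⊤ := ENNReal.one_lt_top
  have hW00 : haraWBar d 0 0 < ⊤ := (haraWBar_zero_zero_le hβ).trans_lt (ENNReal.add_lt_top.2 ⟨hW, hone⟩)
  have hW0β : haraWBar d 0 β < ⊤ := by rwa [haraWBar_comm]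
  have hΔ : percTriBar d < ⊤ := by rwa [← haraTBar_zero_zero_eq]
  have hΔt : percTriTildeBar d < ⊤ :=
    percTriTildeBar_le.trans_lt (ENNReal.mul_lt_top (ENNReal.mul_lt_top (by simp) (by simp)) hΔ)
  have hKB : KB d < ⊤ := ENNReal.mul_lt_top (ENNReal.mul_lt_top (by simp) hΔt) hΔ
  -- the patterns without `c`-mark are all `(0,0)`
  have hC0 : ∀ e ∈ patsC (0 : ℝ), e = ((0 : ℝ), (0 : ℝ)) := fun e he => by
    simpa [patsC] using he
  have hS : Ssum d 0 < ⊤ := sum_map_lt_top fun e he => by rw [hC0 e he]; exact hT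
  have hRe : ∀ e ∈ patsC (0 : ℝ), rungB d e < ⊤ := fun e he => by
    rw [hC0 e he]; exact ENNReal.mul_lt_top (pivC_lt_top _) (ENNReal.add_lt_top.2 ⟨hT, hT⟩)
  have hBe : ∀ e ∈ patsC (0 : ℝ), b2B d e < ⊤ := fun e he => by
    rw [hC0 e he]; exact ENNReal.add_lt_top.2 ⟨hT, ENNReal.mul_lt_top (wE_zero_lt_top _) hT⟩
  have hR : Rsum d 0 < ⊤ := sum_map_lt_top hRe
  have hU : Usum d 0 < ⊤ := ENNReal.add_lt_top.2 ⟨hKB, sum_map_lt_top fun e₁ h₁ =>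
    sum_map_lt_top fun e₂ h₂ => ENNReal.mul_lt_top (hBe e₂ h₂) (hRe e₁ h₁)⟩
  -- the patterns with the `b`-mark: `(0,0)`, `(β,0)`, `(0,β)`
  have hWe : ∀ e ∈ pats β (0 : ℝ), haraWBar d e.1 e.2 < ⊤ ∧ haraWBar d e.1 0 < ⊤ := fun e he => by
    simp only [pats, List.mem_cons, List.mem_nil_iff, or_false] at he
    rcases he with rfl | rfl | rfl | rfl | rfl | rfl | rfl
    · exact ⟨hW00, hW00⟩
    · exact ⟨hW, hW⟩
    · exact ⟨hW0β, hW00⟩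
    · exact ⟨hW00, hW00⟩
    · exact ⟨hW00, hW00⟩
    · exact ⟨hW, hW⟩
    · exact ⟨hW0β, hW00⟩
  have hM : Msum d β 0 < ⊤ := sum_map_lt_top fun e he =>
    ENNReal.mul_lt_top (pivC_lt_top _) (ENNReal.add_lt_top.2 (hWe e he))
  have hWs : Wsum d β 0 < ⊤ := sum_map_lt_top fun e he => (hWe e he).1
  have hHB : hB d β < ⊤ := ENNReal.mul_lt_top (ENNReal.pow_lt_top ENNReal.ofReal_lt_top)
    (ENNReal.mul_lt_top (ENNReal.pow_lt_top (ENNReal.mul_lt_top (by simp) (by simp))) hH)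
  have hS1 := ENNReal.add_lt_top.2 ⟨hone, hS⟩
  have hU1 := ENNReal.add_lt_top.2 ⟨hone, hU⟩
  have hM1 := ENNReal.add_lt_top.2 ⟨hone, hM⟩
  have hR1 := ENNReal.add_lt_top.2 ⟨hone, hR⟩
  have hW1 := ENNReal.add_lt_top.2 ⟨hone, hWs⟩
  have hT1 := ENNReal.add_lt_top.2 ⟨hone, hT⟩
  unfold CbigH
  refine ENNReal.mul_lt_top (ENNReal.mul_lt_top (ENNReal.pow_lt_top hS1) (ENNReal.pow_lt_top hU1))
    (ENNReal.add_lt_top.2 ⟨ENNReal.add_lt_top.2 ⟨ENNReal.add_lt_top.2 ⟨ENNReal.mul_lt_top hM1 hR1,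
      ENNReal.mul_lt_top hW1 (ENNReal.pow_lt_top hR1)⟩, ENNReal.mul_lt_top (ENNReal.mul_lt_top hM1 hT1) hR1⟩, hHB⟩)

/-- **Hara's weighted `N`-loop estimate at `γ = 0` with the PRINTED hypotheses** `W̄^{(β,0)}, T̄^{(0,0)}, H̄^{(β)} < ∞`
(and `K = 2Δ̃_{p_c}Δ_{p_c} < 1`): `Σ_x |x|^β [diagram of Π^{(N)}](x) ≤ c (N+1)^{2+β} ρ^N`, `ρ < 1`, `N ≥ 1` — stated with
the exponent written `β + 0` (the form consumed by `summable_weight_mul_abs_of_weightedBound`).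
[cite: Hara2008, §3.4 (Steps 1–3, cases (b-2), (b-3), (b-7))] [cite: HeydenreichVanDerHofstad2017, Prop. 7.4 and §7.5.2] -/
theorem weightedNLoopBoundH_of_small {β : ℝ} (hβ : 0 ≤ β) (hW : haraWBar d β 0 < ⊤) (hT : haraTBar d 0 0 < ⊤)
    (hH : haraHBar d β < ⊤) (hK : KB d < 1) :
    ∃ c ρ : ℝ, 0 < ρ ∧ ρ < 1 ∧ ∀ N : ℕ, 1 ≤ N →
      ∑' x : Site d, ENNReal.ofReal (euclidNorm x ^ (β + 0)) * piNDiagramPc d N x ≤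
        ENNReal.ofReal (c * ((N : ℝ) + 1) ^ (2 + β + 0) * ρ ^ N) := by
  have hW00 : haraWBar d 0 0 < ⊤ :=
    (haraWBar_zero_zero_le hβ).trans_lt (ENNReal.add_lt_top.2 ⟨hW, ENNReal.one_lt_top⟩)
  have h00 : Cbig d 0 0 < ⊤ := Cbig_lt_top le_rfl le_rfl hW00 hT hT (Or.inl rfl) (Or.inl rfl)
  have hββ : (if β = 0 then Cbig d 0 0 else CbigH d β) < ⊤ := by
    split_ifs
    · exact h00
    · exact CbigH_lt_top hβ hW hT hH
  refine weightedNLoopBound_of_chains hβ le_rfl (fun b' _ => if b' = 0 then Cbig d 0 0 else CbigH d b')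
    ⟨by rw [if_pos rfl]; exact h00, by rw [if_pos rfl]; exact h00, hββ, hββ⟩ (fun n b' c' j l hb' hc' hj hl => ?_) hK
  obtain rfl : c' = 0 := hc'.elim id id
  by_cases h0 : b' = 0
  · subst h0
    rw [if_pos rfl]
    exact chain_exv_le le_rfl le_rfl hK.le n hj hl
  · rw [if_neg h0]
    obtain rfl : b' = β := hb'.resolve_left h0
    exact chain_exv_zero_right_le hβ hK.le n l hj

/-- **Hara 2008, Lemma 1.6 (percolation) at `γ = 0`, with the printed hypotheses**: from the Hara–Slade
coefficients at `p_c` (`HvdH2017_piNDiagramBoundPc`) and `2Δ̃_{p_c}Δ_{p_c} < 1` for `d ≥ 11`: for the lace-expansion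
coefficient `Φ` and `β ≥ 0` with `W̄^{(β,0)}, T̄^{(0,0)}, H̄^{(β)} < ∞`, `Σ_x |x|^β |Φ(x)| < ∞`.
[cite: Hara2008, Lemma 1.6 and §3.4 (Steps 1–3 and Summary)] [cite: HeydenreichVanDerHofstad2017, (7.4.10) and Cor. 8.13] -/
theorem Hara2008_lemma16H_of_diagramBounds (h₁ : HvdH2017_piNDiagramBoundPc)
    (hsmall : ∀ d : ℕ, 11 ≤ d → KB d < 1) :
    ∀ (d : ℕ), 11 ≤ d → ∀ Φ : Site d → ℝ, IsLaceCoefficientPc d Φ →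
      ∀ β : ℝ, 0 ≤ β → haraWBar d β 0 < ⊤ → haraTBar d 0 0 < ⊤ → haraHBar d β < ⊤ →
        Summable fun x : Site d => euclidNorm x ^ β * |Φ x| := by
  intro d hd Φ hΦ β hβ hW hT hH
  obtain ⟨c, ρ, hρ0, hρ1, hB⟩ := weightedNLoopBoundH_of_small hβ hW hT hH (hsmall d hd)
  have h := summable_weight_mul_abs_of_weightedBound h₁ hd hΦ hβ le_rfl hW hρ0 hρ1 hB
  simpa only [add_zero] using h

/-- **Hara 2008, Lemma 1.6 (percolation) with the printed hypotheses and ONE conditional addition** — the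
statement the printed case analysis of §3.4 proves on the diagrams (7.4.10): for `d ≥ 11`, the lace-expansion
coefficient `Φ`, `β, γ ≥ 0` with `W̄^{(β,γ)}, T̄^{(0,γ)}, H̄^{(β)} < ∞` AND, when `γ > 0`, `T̄^{(0,β)} < ∞` (the `γ`-mark
on the pivotal line at the vertex `v` of `H^{(β)}`, not covered by (b-2)/(b-3)/(b-7)), `Σ_x |x|^{β+γ} |Φ(x)| < ∞`;
from `HvdH2017_piNDiagramBoundPc` and `2Δ̃_{p_c}Δ_{p_c} < 1` (`d ≥ 11`). At `γ = 0` this is Lemma 1.6 as printed.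
[cite: Hara2008, Lemma 1.6 and §3.4 (Steps 1–3 and Summary)] [cite: HeydenreichVanDerHofstad2017, (7.4.10) and Cor. 8.13] -/
theorem Hara2008_lemma16_of_diagramBounds (h₁ : HvdH2017_piNDiagramBoundPc)
    (hsmall : ∀ d : ℕ, 11 ≤ d → KB d < 1) :
    ∀ (d : ℕ), 11 ≤ d → ∀ Φ : Site d → ℝ, IsLaceCoefficientPc d Φ →
      ∀ β γ : ℝ, 0 ≤ β → 0 ≤ γ → haraWBar d β γ < ⊤ → haraTBar d 0 γ < ⊤ → haraHBar d β < ⊤ →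
        (0 < γ → haraTBar d 0 β < ⊤) →
        Summable fun x : Site d => euclidNorm x ^ (β + γ) * |Φ x| := by
  intro d hd Φ hΦ β γ hβ hγ hW hT hH hTβ
  rcases hγ.eq_or_lt with hγ0 | hγpos
  · subst hγ0
    have h := Hara2008_lemma16H_of_diagramBounds h₁ hsmall d hd Φ hΦ β hβ hW hT hH
    simpa only [add_zero] using h
  · exact Hara2008_lemma16T_of_diagramBounds h₁ hsmall d hd Φ hΦ β γ hβ hγ hW hT (hTβ hγpos)

/-- **Lemma 1.6 with the printed hypotheses plus `0 < γ → T̄^{(0,β)} < ∞`, from the two named inputs of the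
catalogue** (`HvdH2017_piNDiagramBoundPc`, `FitznerVanDerHofstad2017_triangleBoundsPc`).
[cite: Hara2008, Lemma 1.6 and §3.4] [cite: FitznerVanDerHofstad2017, §7 (7.1) and proof of Thm. 1.5] -/
theorem Hara2008_lemma16_of_triangleBounds (h₁ : HvdH2017_piNDiagramBoundPc)
    (hnum : FitznerVanDerHofstad2017_triangleBoundsPc) :
    ∀ (d : ℕ), 11 ≤ d → ∀ Φ : Site d → ℝ, IsLaceCoefficientPc d Φ →
      ∀ β γ : ℝ, 0 ≤ β → 0 ≤ γ → haraWBar d β γ < ⊤ → haraTBar d 0 γ < ⊤ → haraHBar d β < ⊤ →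
        (0 < γ → haraTBar d 0 β < ⊤) →
        Summable fun x : Site d => euclidNorm x ^ (β + γ) * |Φ x| :=
  Hara2008_lemma16_of_diagramBounds h₁ fun _ hd => hnum.two_mul_percTriTildeBar_mul_percTriBar_lt_one hd

/-- **`Hara2008_lemma16Pc` (the printed hypotheses verbatim) from the two named inputs and the single missing
estimate**: if, at `p_c` in `d ≥ 11`, `T̄^{(0,β)} < ∞` whenever `W̄^{(β,γ)}, T̄^{(0,γ)}, H̄^{(β)} < ∞` with `γ > 0`
(which the printed proof does not show), then the named fact holds.
[cite: Hara2008, Lemma 1.6 and §3.4] -/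
theorem Hara2008_lemma16Pc_of_triangleBounds (h₁ : HvdH2017_piNDiagramBoundPc)
    (hnum : FitznerVanDerHofstad2017_triangleBoundsPc)
    (hgap : ∀ (d : ℕ), 11 ≤ d → ∀ β γ : ℝ, 0 ≤ β → 0 < γ → haraWBar d β γ < ⊤ → haraTBar d 0 γ < ⊤ →
      haraHBar d β < ⊤ → haraTBar d 0 β < ⊤) :
    Hara2008_lemma16Pc :=
  fun d hd Φ hΦ β γ hβ hγ hW hT hH =>
    Hara2008_lemma16_of_triangleBounds h₁ hnum d hd Φ hΦ β γ hβ hγ hW hT hH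
      fun hγpos => hgap d hd β γ hβ hγpos hW hT hH

/-- **`Hara2008_weightedNLoopBoundPc` (its printed hypotheses `W̄^{(β,γ)}, W̄^{(β,0)}, T̄^{(0,γ)}, H̄^{(β)} < ∞`) from the
numerical triangle bounds and the single missing estimate** `T̄^{(0,β)} < ∞` for `γ > 0`: at `γ = 0` by the
`H`-route of this file, at `γ > 0` by the `T̄^{(0,β)}`-variant (`LaceExpansionXSpaceWeightedNLoop.lean`).
[cite: Hara2008, §3.4 (Steps 1–3 and Summary)] [cite: FitznerVanDerHofstad2017, §7 (7.1) and proof of Thm. 1.5] -/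
theorem Hara2008_weightedNLoopBoundPc_of_triangleBounds (hnum : FitznerVanDerHofstad2017_triangleBoundsPc)
    (hgap : ∀ (d : ℕ), 11 ≤ d → ∀ β γ : ℝ, 0 ≤ β → 0 < γ → haraWBar d β γ < ⊤ → haraTBar d 0 γ < ⊤ →
      haraHBar d β < ⊤ → haraTBar d 0 β < ⊤) :
    Hara2008_weightedNLoopBoundPc := by
  intro d hd β γ hβ hγ hW hW0 hT hH
  have hK : KB d < 1 := hnum.two_mul_percTriTildeBar_mul_percTriBar_lt_one hd
  rcases hγ.eq_or_lt with hγ0 | hγpos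
  · subst hγ0
    exact weightedNLoopBoundH_of_small hβ hW0 hT hH hK
  · exact weightedNLoopBound_of_small hβ hγ hW hT (hgap d hd β γ hβ hγpos hW hT hH) hK

/-! ### With the Hara–Slade coefficients below the diagrams PROVED (`HvdH2017_piNDiagramBoundPc_holds`,
`LaceExpansionDiagramBound7410.lean`): Lemma 1.6 from the numerical triangle bounds alone -/

/-- **Lemma 1.6, `T̄^{(0,β)}`-variant, for `d ≥ 11` from `FitznerVanDerHofstad2017_triangleBoundsPc` alone.**
[cite: Hara2008, Lemma 1.6 and §3.4] [cite: FitznerVanDerHofstad2017, §7 (7.1) and proof of Thm. 1.5] -/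
theorem Hara2008_lemma16T_of_numerics (hnum : FitznerVanDerHofstad2017_triangleBoundsPc) :
    ∀ (d : ℕ), 11 ≤ d → ∀ Φ : Site d → ℝ, IsLaceCoefficientPc d Φ →
      ∀ β γ : ℝ, 0 ≤ β → 0 ≤ γ → haraWBar d β γ < ⊤ → haraTBar d 0 γ < ⊤ → haraTBar d 0 β < ⊤ →
        Summable fun x : Site d => euclidNorm x ^ (β + γ) * |Φ x| :=
  Hara2008_lemma16T_of_triangleBounds HvdH2017_piNDiagramBoundPc_holds hnum

/-- **Lemma 1.6 with the printed hypotheses plus `0 < γ → T̄^{(0,β)} < ∞`, for `d ≥ 11`, from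
`FitznerVanDerHofstad2017_triangleBoundsPc` alone** (at `γ = 0`: Lemma 1.6 exactly as printed).
[cite: Hara2008, Lemma 1.6 and §3.4] [cite: FitznerVanDerHofstad2017, §7 (7.1) and proof of Thm. 1.5] -/
theorem Hara2008_lemma16_of_numerics (hnum : FitznerVanDerHofstad2017_triangleBoundsPc) :
    ∀ (d : ℕ), 11 ≤ d → ∀ Φ : Site d → ℝ, IsLaceCoefficientPc d Φ →
      ∀ β γ : ℝ, 0 ≤ β → 0 ≤ γ → haraWBar d β γ < ⊤ → haraTBar d 0 γ < ⊤ → haraHBar d β < ⊤ →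
        (0 < γ → haraTBar d 0 β < ⊤) →
        Summable fun x : Site d => euclidNorm x ^ (β + γ) * |Φ x| :=
  Hara2008_lemma16_of_triangleBounds HvdH2017_piNDiagramBoundPc_holds hnum

/-- **`Hara2008_lemma16Pc` from the numerical triangle bounds and the single estimate the printed proof does not
supply** (`T̄^{(0,β)} < ∞` for `γ > 0` under the printed hypotheses). [cite: Hara2008, Lemma 1.6 and §3.4] -/
theorem Hara2008_lemma16Pc_of_numerics (hnum : FitznerVanDerHofstad2017_triangleBoundsPc)
    (hgap : ∀ (d : ℕ), 11 ≤ d → ∀ β γ : ℝ, 0 ≤ β → 0 < γ → haraWBar d β γ < ⊤ → haraTBar d 0 γ < ⊤ →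
      haraHBar d β < ⊤ → haraTBar d 0 β < ⊤) :
    Hara2008_lemma16Pc :=
  Hara2008_lemma16Pc_of_triangleBounds HvdH2017_piNDiagramBoundPc_holds hnum hgap

end HRoute

end Literature.Barriers.CriticalPhenomena
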